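import Summits.ResolutionOfSingularities.ResolutionOfSingularities.Theorems.FrobeniusClosingSteerNotCoarseningArchSeq
import Mathlib.RingTheory.Valuation.RankOne
import HarnessLib

/-!
# Crux `Steer` (stmt-ResolutionOfSingularities-16345), line `switching_dichotomy`: NO ETERNAL AFFINE RUN ⇒ DIVERGENT
# exceptional values (the (α) heart Φ3ᴸˢ / Φ4ᴸˢ / S3 lives at `Σ v(𝔪_i) = ∞`)

OURS (campaign `res-hironaka`, rung L ★L-G4, slot W4.1, chain W4.1; seat `res-L0-w41-stub-4` g3; Theses-free helper for the
holder res-L0-w41-lead-1's line `switching_dichotomy` (skeleton r22: the `het` test of `concl_of_phasesSSL` precedes the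
Φ3ᴸˢ/Φ4ᴸˢ — resp. strat-1's S0–S3 — split) ; replaces the role of no printed item; NOT a statement of the manuscript under
review [claim: Hironaka2017, status: under-review]; AI-produced, which is weaker than expert review). Sequel of
`FrobeniusClosingSteerEventualStep.lean` (E-4 `exists_isTorsorRun_of_tail`).

* **E-6 `exists_tail_above_of_bounded` (real analysis, rank one).** If the valuation has rank one and the partial products
  of the values `v (x i) ≤ 1` stay above some non-zero value (`∀ n, v c ≤ ∏_{i<n} v (x i)`, i.e. `Σ v(𝔪_i) < ∞`), then for
  every budget `β = v m < 1` and every `N` some TAIL from a stage `M ≥ N` stays above the budget: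
  `∀ j, v m < ∏_{i<j} v (x (M + i))`. (Embed the value group in `ℝ≥0`; a decreasing sequence bounded below by a positive
  number has a positive infimum `L`; choose `M` with `P_M < L / β`.)
* **E-7 `divergent_of_forall_not_isTorsorRun`.** Pure logic over E-6 and the CONCLUSION of E-4
  (`EventualMonomial.exists_isTorsorRun_of_tail`, p503868, taken verbatim as the hypothesis `hrun` so that this file does
  not wait for that module's build; the consumer composes the two): if the radicand `t` starts NO eternal affine torsor
  run at ANY stage along the (shifted) point sequence, then the exceptional values DIVERGE — every non-zero value is
  undercut by some partial product, `∀ c ≠ 0, ∃ n, ∏_{i<n} v (x i) < v c` (additively `Σ_i v(𝔪_i) = ∞`). In the (α) heart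
  (strongly switching, no proper coarsening, no member toroidally log-final, `t ∉ Frac A₀` cleanable) `hrun` is E-4.

Consequence for the registered residuals (reading, kernel-checked as far as stated): Φ4ᴸˢ carries «no eternal affine run
from any generator at any stage» as a hypothesis, and Φ3ᴸˢ / S3 are only invoked after the same `het` test — so all three
live on data with `Σ v(𝔪_i) = ∞`, which by the landed Granja–Martínez–Rodríguez theorem
(`stronglySwitching_of_divergent`, p505426) are strongly switching AUTOMATICALLY and by
[HeinzerOlberdingToeniskoetter2017, Prop. 6.2 (3)] have rational rank one. The holder may add
`∀ c ≠ 0, ∃ n, ∏_{i<n} v (x i) < v c` as a free hypothesis of the residuals at the next reshape.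
-/

-- `Summit.<S>.<S>.…` duplicates the summit name by design (single-problem summit).
set_option linter.dupNamespace false

open IsLocalRing
open Literature.AlgebraicGeometry.Resolution
open scoped NNReal

namespace Summit.ResolutionOfSingularities.ResolutionOfSingularities.Theorems.SwitchingDichotomy

namespace EventualMonomial

open Summit.ResolutionOfSingularities.ResolutionOfSingularities.Theorems.SteerRankThinness
  (HasProperCoarsening rankOne_of_not_hasProperCoarsening)

variable {k K : Type} [Field k] [Field K] [Algebra k K]

/-! ## E-6 · a summable sequence of values has tails above any budget (rank one) -/

/-- **E-6 · tails above the budget.** For a rank-one valuation and values `v (x i) ≤ 1` (`x i ≠ 0`) whose partial products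
stay above a non-zero value `v c` (`Σ v(x_i) < ∞` additively), every budget `v m < 1` (`m ≠ 0`) is undercut by NO tail
from some stage `M ≥ N` on: `∀ j, v m < ∏_{i<j} v (x (M + i))`. [folklore] -/
theorem exists_tail_above_of_bounded (O : ValuationSubring K) (hr : Nonempty O.valuation.RankOne)
    (x : ℕ → K) (hx0 : ∀ i, x i ≠ 0) (hx1 : ∀ i, O.valuation (x i) ≤ 1)
    (c : K) (hc0 : c ≠ 0) (hbound : ∀ n, O.valuation c ≤ ∏ i ∈ Finset.range n, O.valuation (x i))
    (m : K) (hm0 : m ≠ 0) (hm1 : O.valuation m < 1) (N : ℕ) :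
    ∃ M, N ≤ M ∧ ∀ j, O.valuation m < ∏ i ∈ Finset.range j, O.valuation (x (M + i)) := by
  classical
  obtain ⟨hr⟩ := hr
  -- the real-valued shadow `f y := hom (v.restrict y)` of the valuation
  let v := O.valuation
  let f : K → ℝ≥0 := fun y => Valuation.RankOne.hom v (v.restrict y)
  have hf_mul : ∀ a b : K, f (a * b) = f a * f b := fun a b => by
    simp only [f, map_mul]
  have hf_lt : ∀ a b : K, f a < f b ↔ v a < v b := fun a b => by
    rw [(Valuation.RankOne.strictMono v).lt_iff_lt, Valuation.restrict_lt_iff]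
  have hf_le : ∀ a b : K, f a ≤ f b ↔ v a ≤ v b := fun a b => by
    rw [(Valuation.RankOne.strictMono v).le_iff_le, Valuation.restrict_le_iff]
  have hf_pos : ∀ a : K, a ≠ 0 → 0 < f a := fun a ha =>
    pos_iff_ne_zero.2 fun h => ((Valuation.ne_zero_iff _).2 ha) (Valuation.RankOne.zero_of_hom_zero _ h)
  -- partial products `π n := ∏_{i<n} x i` and their shadows `P n := f (π n)`
  let π : ℕ → K := fun n => ∏ i ∈ Finset.range n, x i
  have hπ0 : ∀ n, π n ≠ 0 := fun n => Finset.prod_ne_zero_iff.mpr fun i _ => hx0 i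
  have hvπ : ∀ n, v (π n) = ∏ i ∈ Finset.range n, v (x i) := fun n => map_prod _ _ _
  let P : ℕ → ℝ≥0 := fun n => f (π n)
  have hPpos : ∀ n, 0 < P n := fun n => hf_pos _ (hπ0 n)
  have hPsucc : ∀ n, P (n + 1) = P n * f (x n) := fun n => by
    show f (π (n + 1)) = f (π n) * f (x n)
    rw [← hf_mul]
    simp only [π, Finset.prod_range_succ]
  have hPanti : ∀ n j, P (n + j) ≤ P n := by
    intro n j
    induction j with
    | zero => exact le_rfl
    | succ j ih =>
      rw [← Nat.add_assoc, hPsucc]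
      have h1 : f (x (n + j)) ≤ 1 := by
        have := (hf_le (x (n + j)) 1).mpr (by rw [map_one]; exact hx1 _)
        simpa [f, map_one] using this
      exact (mul_le_of_le_one_right zero_le h1).trans ih
  -- the positive infimum `L`
  have hcP : ∀ n, f c ≤ P n := fun n => (hf_le c (π n)).mpr (by rw [hvπ]; exact hbound n)
  let L : ℝ≥0 := ⨅ n, P n
  have hLle : ∀ n, L ≤ P n := fun n => ciInf_le (OrderBot.bddBelow _) n
  have hcL : f c ≤ L := le_ciInf hcP
  have hLpos : 0 < L := lt_of_lt_of_le (hf_pos c hc0) hcL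
  -- the budget
  have hβ1 : f m < 1 := by
    have := (hf_lt m 1).mpr (by rw [map_one]; exact hm1)
    simpa [f, map_one] using this
  have hβpos : 0 < f m := hf_pos m hm0
  -- a stage `M ≥ N` with `P M < L / f m`
  have hLlt : L < L / f m := by
    rw [lt_div_iff₀ hβpos]
    exact mul_lt_of_lt_one_right hLpos hβ1
  have hshift : (⨅ n, P (N + n)) = L := by
    apply le_antisymm
    · -- `L = inf P ≥ inf of the shifted sequence` since `P (N + n) ≤ P n`
      refine le_ciInf fun n => ?_
      exact (ciInf_le (OrderBot.bddBelow _) n).trans (hPanti n N |>.trans_eq' (by rw [Nat.add_comm]))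
    · exact le_ciInf fun n => hLle (N + n)
  obtain ⟨M₀, hM₀⟩ : ∃ M₀, P (N + M₀) < L / f m := by
    have h : (⨅ n, P (N + n)) < L / f m := by rw [hshift]; exact hLlt
    exact exists_lt_of_ciInf_lt h
  refine ⟨N + M₀, Nat.le_add_right N M₀, fun j => ?_⟩
  -- the tail product from `M := N + M₀` is `P (M + j) / P M > f m`
  have htail : f (∏ i ∈ Finset.range j, x (N + M₀ + i)) * P (N + M₀) = P (N + M₀ + j) := by
    show f _ * f (π (N + M₀)) = f (π (N + M₀ + j))
    rw [← hf_mul, mul_comm]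
    congr 1
    exact (Finset.prod_range_add x (N + M₀) j).symm
  have hlt : f m < f (∏ i ∈ Finset.range j, x (N + M₀ + i)) := by
    rw [lt_div_iff₀ hβpos] at hM₀
    -- `f m * P M < L ≤ P (M + j) = tail * P M`
    have h1 : f m * P (N + M₀) < f (∏ i ∈ Finset.range j, x (N + M₀ + i)) * P (N + M₀) := by
      rw [htail, mul_comm]
      exact hM₀.trans_le (hLle _)
    exact lt_of_mul_lt_mul_right h1 zero_le
  have := (hf_lt _ _).mp hlt
  rwa [map_prod] at this

/-! ## E-7 · no eternal affine run ⇒ divergent exceptional values -/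

/-- **E-7 · no eternal affine run ⇒ `Σ v(𝔪_i) = ∞`.** For a rank-one valuation, members `R i ⊆ O`-style data
(`v (x i) < 1` for the exceptional parameters), the conclusion of E-4 as hypothesis `hrun` (a budget `m` and a stage `N`
beyond which every tail of exceptional values staying above `v m` starts an eternal affine torsor run from `t`), and NO
eternal affine torsor run from `t` at any stage `M` along `j ↦ R (M + j)` (`IsTorsorRun` unfolded): the exceptional
values DIVERGE, `∀ c ≠ 0, ∃ n, ∏_{i<n} v (x i) < v c`. In the skeleton: after the `het` test of `concl_of_phasesSSL`
the residuals Φ3ᴸˢ / Φ4ᴸˢ / S3 only meet data with `Σ v(𝔪_i) = ∞`. [cite: HeinzerOlberdingToeniskoetter2017, Prop. 6.2]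
[folklore] -/
theorem divergent_of_forall_not_isTorsorRun (p : ℕ) (O : ValuationSubring K) (hr : Nonempty O.valuation.RankOne)
    (R : ℕ → Subring K) (t : K) (i₀ : ℕ)
    (hrun : ∃ N : ℕ, i₀ ≤ N ∧ ∃ (m : K) (g : K), m ≠ 0 ∧ O.valuation m < 1 ∧ m ∈ R N ∧ g ∈ R i₀ ∧
      ∀ M, N ≤ M → ∀ x : ℕ → K,
        (∀ j, x j ∈ R (M + j) ∧ x j ≠ 0 ∧ O.valuation (x j) < 1 ∧
          ∀ y ∈ R (M + j), O.valuation y < 1 → O.valuation y ≤ O.valuation (x j)) →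
        (∀ j, O.valuation m < ∏ i ∈ Finset.range j, O.valuation (x i)) →
        ∃ u : ℕ → K, u 0 = t ∧ (∀ j, u j ^ p ∈ R (M + j)) ∧
          ∀ j, ∃ x' g' : K, (x' ∈ R (M + j) ∧ x' ≠ 0 ∧ O.valuation x' < 1 ∧
              ∀ y ∈ R (M + j), O.valuation y < 1 → O.valuation y ≤ O.valuation x') ∧
            g' ∈ R (M + j) ∧ u j = x' * u (j + 1) + g')
    (hnet : ∀ (M : ℕ) (u : ℕ → K), u 0 = t → (∀ j, u j ^ p ∈ R (M + j)) →
      (∀ j, ∃ x' g' : K, (x' ∈ R (M + j) ∧ x' ≠ 0 ∧ O.valuation x' < 1 ∧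
          ∀ y ∈ R (M + j), O.valuation y < 1 → O.valuation y ≤ O.valuation x') ∧
        g' ∈ R (M + j) ∧ u j = x' * u (j + 1) + g') → False)
    (x : ℕ → K)
    (hx : ∀ i, x i ∈ R i ∧ x i ≠ 0 ∧ O.valuation (x i) < 1 ∧
      ∀ y ∈ R i, O.valuation y < 1 → O.valuation y ≤ O.valuation (x i)) :
    ∀ c : K, c ≠ 0 → ∃ n, (∏ i ∈ Finset.range n, O.valuation (x i)) < O.valuation c := by
  classical
  intro c hc0
  by_contra hcon
  push Not at hcon
  obtain ⟨N, -, m, g, hm0, hvm, -, -, hrunN⟩ := hrun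
  -- E-6 on the shifted values `i ↦ x (N + i)`: a tail above the budget from some stage
  have hbound : ∀ n, O.valuation c ≤ ∏ i ∈ Finset.range n, O.valuation (x (N + i)) := by
    intro n
    refine (hcon (N + n)).trans ?_
    rw [Finset.prod_range_add]
    refine mul_le_of_le_one_left zero_le ?_
    exact Finset.prod_le_one (fun i _ => zero_le) fun i _ => (hx i).2.2.1.le
  obtain ⟨M₀, -, htail⟩ := exists_tail_above_of_bounded O hr (fun i => x (N + i)) (fun i => (hx _).2.1)
    (fun i => (hx _).2.2.1.le) c hc0 hbound m hm0 hvm 0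
  -- the run at stage `N + M₀` with the exceptional parameters `j ↦ x (N + M₀ + j)`
  obtain ⟨u, hu0, hup, hus⟩ := hrunN (N + M₀) (Nat.le_add_right N M₀) (fun j => x (N + M₀ + j))
    (fun j => hx (N + M₀ + j)) (fun j => by
      have h := htail j
      simpa only [Nat.add_assoc] using h)
  exact hnet (N + M₀) u hu0 hup hus

end EventualMonomial

end Summit.ResolutionOfSingularities.ResolutionOfSingularities.Theorems.SwitchingDichotomy
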